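import Mathlib
import Summits.NavierStokesRegularity.NavierStokesRegularity.Theorems.EulerZoomLiouvillePowerGaugeEulerLiouvilleWrongParityMember
import Literature.Analysis.FluidPDE.ElgindiWeightedIBP
import HarnessLib

/-!
# Crux `EulerZoomLiouville.PowerGaugeEulerLiouville` (stmt-NavierStokesRegularity-19832), stub `stub_nonSelfSimilarRest`:
# MEMBERS WITH FROZEN (distributionally time-independent) WEAK VORTICITY ON A PAST SLAB ARE TRIVIAL

Helper file (theorems only; `--supports stmt-NavierStokesRegularity-19832`; def-free).  Hand leafhand-ns-eulerzoomliouville-10 g3; a symmetry-free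
generalisation of `…WrongParityMember` / `…AntiPeriodicMember`.

PRINCIPLE.  In the wrong-parity files the `±` pair served only to show that the time-tested velocity `w_θ = ∫θ'(t)u(t,·)dt` is weakly CURL-FREE;
incompressibility makes it divergence-free and the `A`-gauge gives it sub-volume growth, so it vanishes (`AntiMember.timeTested_ae_eq_zero`).  Hence the
bare hypothesis «`∂ₜ curl u = 0` in `𝒟'((−∞,T₁) × ℝ³)`» — FROZEN WEAK VORTICITY, with the velocity itself a priori free to carry a time-dependent
potential part — already forces `∂ₜu = 0` in `𝒟'`, a.e. steadiness (`DistSteady.exists_ae_eq_slice`) and triviality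
(`AePastSteady.ae_eq_zero_of_gauge_of_aePastSteady`): the potential part is a harmonic gradient of sub-volume growth, hence zero.

* `FrozenCurl.integral_deriv_mul_inner_eq_zero` — `A`-gauge + frozen weak vorticity ⇒ distributionally steady;
* `Loc.ae_eq_zero_of_frozenCurl` — MEMBER LEVEL, every `ρ > 0`, no regularity: crux hypotheses + `∫∫ θ'(t)⟪u, (∂ₐg)c − (∂_c g)a⟫ = 0` for all
  `θ ∈ C_c^∞((−∞,T₁))`, scalar tests `g`, vectors `a, c` ⇒ `u = 0` a.e.;
* `Loc.ae_eq_zero_of_frozenWeakGradientCurl` — the same with the hypothesis on the antisymmetric part of the weak gradient `H`: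
  `∫∫ θ'(t) g(x) (⟪H a, c⟫ − ⟪H c, a⟫) = 0`; this contains the tree's steady (`PastSteady`) and weakly-irrotational-past (`PastWeak`) strata;
* `Birth.nonSelfSimilar_of_frozenWeakVorticity` — binder language.

WHAT THIS IS NOT: not a proof of the stub or of the crux; nothing about Navier–Stokes. [folklore; LemarieRieusset2016 Thm 4.4]
-/

noncomputable section

-- flat `Theorems/<Route><Decl>…` files of one crux share the namespace of the crux (tree convention)
set_option linter.dupNamespace false

open MeasureTheory Set Filter Topology Metric Function TopologicalSpace
open scoped RealInnerProductSpace NNReal ENNReal ContDiff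

namespace Summit.NavierStokesRegularity.NavierStokesRegularity.Theorems.PowerGaugeEulerLiouville

open Literature.Analysis Literature.Analysis.FunctionSpaces Literature.Analysis.FluidPDE

/-! ## 1. Frozen weak vorticity ⇒ distributionally steady -/

/-- **FROZEN WEAK VORTICITY + `A`-GAUGE ⇒ DISTRIBUTIONALLY STEADY.**  Let `(u, p)` be a suitable weak Euler pair on `(−∞,0) × ℝ³` with
`a^{2ρ} A(a) ≤ c` (`ρ > −1`), `θ ∈ C_c^∞((−∞,T₁))`, `T₁ ≤ 0`, and suppose `∫∫ θ'(t)⟪u, (∂ₐg)c − (∂_c g)a⟫ = 0` for all scalar tests `g` and all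
`a, c` (the weak vorticity does not see `θ'`: frozen vorticity).  Then `∫∫ θ'(t)⟪u(t,x), Φ(x)⟫ = 0` for every continuous compactly supported `Φ`.
[folklore] -/
theorem FrozenCurl.integral_deriv_mul_inner_eq_zero {ρ : ℝ} (hρ : -1 < ρ)
    {u : ℝ → EuclideanSpace ℝ (Fin 3) → EuclideanSpace ℝ (Fin 3)} {p : ℝ → EuclideanSpace ℝ (Fin 3) → ℝ} {c : ℝ≥0}
    (hsw : IsSuitableWeakSolutionOn (slab (EuclideanSpace ℝ (Fin 3)) (Iio 0) isOpen_Iio) 0 0 u p)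
    (hA : ∀ a : ℝ, 0 < a → ENNReal.ofReal (a ^ (2 * ρ)) * cknA a (0 : ℝ × EuclideanSpace ℝ (Fin 3)) u ≤ (c : ℝ≥0∞))
    {T₁ : ℝ} (hT₁ : T₁ ≤ 0)
    {θ : ℝ → ℝ} (hθ : ContDiff ℝ ∞ θ) (hθc : HasCompactSupport θ) (hθT : tsupport θ ⊆ Iio T₁)
    (hvort : ∀ g : EuclideanSpace ℝ (Fin 3) → ℝ, IsTestFunctionOn (⊤ : Opens (EuclideanSpace ℝ (Fin 3))) g →
      ∀ a c : EuclideanSpace ℝ (Fin 3),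
        ∫ z : ℝ × EuclideanSpace ℝ (Fin 3), deriv θ z.1 * ⟪u z.1 z.2, fderiv ℝ g z.2 a • c - fderiv ℝ g z.2 c • a⟫ = 0)
    {Φ : EuclideanSpace ℝ (Fin 3) → EuclideanSpace ℝ (Fin 3)} (hΦ : Continuous Φ) (hΦc : HasCompactSupport Φ) :
    ∫ z : ℝ × EuclideanSpace ℝ (Fin 3), deriv θ z.1 * ⟪u z.1 z.2, Φ z.2⟫ = 0 := by
  have hdist := hsw.distributional
  have hθT0 : tsupport θ ⊆ Iio 0 := hθT.trans (Iio_subset_Iio hT₁)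
  obtain ⟨hκ, hκc, hκT⟩ := AntiMember.deriv_cutoff_props hθ hθc hθT0
  have hκT₁ : tsupport (deriv θ) ⊆ Iio T₁ := tsupport_deriv_subset.trans hθT
  have hu : LocallyIntegrableOn (uncurry u) (Iio 0 ×ˢ (univ : Set (EuclideanSpace ℝ (Fin 3)))) volume := by
    simpa only [coe_slab] using hdist.1
  -- (i) incompressibility, time-tested
  have hdiv : ∀ g : EuclideanSpace ℝ (Fin 3) → ℝ, IsTestFunctionOn (⊤ : Opens (EuclideanSpace ℝ (Fin 3))) g →
      ∫ z : ℝ × EuclideanSpace ℝ (Fin 3), deriv θ z.1 * ⟪u z.1 z.2, gradient g z.2⟫ = 0 := by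
    intro g hg
    have hg' : IsTestFunctionOn (⟨univ, isOpen_univ⟩ : Opens (EuclideanSpace ℝ (Fin 3))) g :=
      ⟨hg.contDiff, hg.hasCompactSupport, fun _ _ => trivial⟩
    have hΘ : IsSpaceTimeTestOn (slab (EuclideanSpace ℝ (Fin 3)) (Iio 0) isOpen_Iio) (fun t x => deriv θ t • g x) :=
      isSpaceTimeTestOn_prod_smul isOpen_Iio isOpen_univ (hθ.deriv') hκc hκT hg'
    have H := hdist.2.2.2.1 _ hΘ
    have hgd : Differentiable ℝ g := hg.contDiff.differentiable (by simp)
    have hpt : ∀ z : ℝ × EuclideanSpace ℝ (Fin 3),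
        ⟪u z.1 z.2, gradient (fun x => deriv θ z.1 • g x) z.2⟫ = deriv θ z.1 * ⟪u z.1 z.2, gradient g z.2⟫ := by
      intro z
      have e : (fun x => deriv θ z.1 • g x) = fun x => deriv θ z.1 * g x := rfl
      rw [e, ClockRigidity.gradient_const_mul' (hgd z.2), real_inner_smul_right]
    have hvan : ∀ z : ℝ × EuclideanSpace ℝ (Fin 3), z ∉ Iio (0 : ℝ) ×ˢ (univ : Set (EuclideanSpace ℝ (Fin 3))) →
        deriv θ z.1 * ⟪u z.1 z.2, gradient g z.2⟫ = 0 := by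
      intro z hz
      have ht : (0 : ℝ) ≤ z.1 := by
        by_contra h
        exact hz ⟨not_le.1 h, mem_univ _⟩
      rw [AntiMember.deriv_eq_zero_of_tsupport_subset_Iio hθT0 ht, zero_mul]
    have H' : ∫ z in Iio (0 : ℝ) ×ˢ (univ : Set (EuclideanSpace ℝ (Fin 3))), deriv θ z.1 * ⟪u z.1 z.2, gradient g z.2⟫ = 0 := by
      refine Eq.trans ?_ H
      rw [coe_slab]
      exact setIntegral_congr_fun (measurableSet_Iio.prod MeasurableSet.univ) (fun z _ => (hpt z).symm)
    rwa [setIntegral_eq_integral_of_forall_compl_eq_zero hvan] at H'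
  -- (iii) growth from the `A`-gauge
  obtain ⟨M, hM⟩ := hκ.bounded_above_of_compact_support hκc
  obtain ⟨a₀, ha₀⟩ := hκc.isCompact.bddBelow
  set a : ℝ := min (a₀ - 1) (T₁ - 1) with hadef
  have hab : a < T₁ := lt_of_le_of_lt (min_le_right _ _) (by linarith)
  have hκS : ∀ t ∉ Ioo a T₁, deriv θ t = 0 := by
    intro t ht
    by_contra hne
    have hts : t ∈ tsupport (deriv θ) := subset_tsupport _ hne
    exact ht ⟨lt_of_le_of_lt (min_le_left _ _) (by linarith [ha₀ hts]), hκT₁ hts⟩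
  have hum : AEStronglyMeasurable (uncurry u) (volume.restrict (Iio (0 : ℝ) ×ˢ (univ : Set (EuclideanSpace ℝ (Fin 3))))) :=
    hu.aestronglyMeasurable
  set r₀ : ℝ := |a| + 1 with hr₀def
  have hgrowth : ∀ r : ℝ, r₀ < r → 0 < r →
      ∫⁻ x in ball (0 : EuclideanSpace ℝ (Fin 3)) r, ‖∫ t, deriv θ t • u t x‖ₑ ^ 2 ≤
        ENNReal.ofReal (M ^ 2 * (T₁ - a) * ((T₁ - a) * c) * r ^ (1 - 2 * ρ)) := by
    intro r hr hr0
    have hr1 : 1 < r := by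
      have : (0 : ℝ) ≤ |a| := abs_nonneg a
      linarith
    have hra : -(r ^ 2) < a := by
      have h1 : |a| < r := by linarith [abs_nonneg a]
      have h2 : r < r ^ 2 := by nlinarith
      have h3 : -|a| ≤ a := neg_abs_le a
      linarith
    have hB : ∀ t ∈ Ioo a T₁, ∫⁻ x in ball (0 : EuclideanSpace ℝ (Fin 3)) r, ‖u t x‖ₑ ^ 2 ≤
        ENNReal.ofReal ((c : ℝ) * r ^ (1 - 2 * ρ)) := fun t ht =>
      Backward.lintegral_ball_le_of_gaugeA hr0 (hA r hr0) ⟨by linarith [ht.1], lt_of_lt_of_le ht.2 hT₁⟩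
    have h1 := AntiMember.lintegral_ball_timeTested_le hum hT₁ hκS hM hB
    refine h1.trans (le_of_eq ?_)
    have hM0 : 0 ≤ M := (norm_nonneg _).trans (hM 0)
    have hTa : 0 ≤ T₁ - a := by linarith
    rw [← ENNReal.ofReal_mul (sq_nonneg M), ← ENNReal.ofReal_mul hTa, ← ENNReal.ofReal_mul (mul_nonneg (sq_nonneg M) hTa)]
    congr 1
    ring
  have hm : 1 - 2 * ρ < 3 := by linarith
  have hw0 := AntiMember.timeTested_ae_eq_zero hu hκ hκc hκT hdiv hvort hm hgrowth
  rw [← AntiMember.integral_inner_timeTested hu hκ hκc hκT hΦ hΦc]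
  have : (fun x => ⟪(∫ t, deriv θ t • u t x), Φ x⟫) =ᵐ[volume] fun _ => (0 : ℝ) := by
    filter_upwards [hw0] with x hx
    rw [hx]; simp
  rw [integral_congr_ae this, integral_zero]


/-! ## 2. Member level and binder language -/

/-- **MEMBERS WITH FROZEN WEAK VORTICITY ON A PAST SLAB ARE TRIVIAL** (member level, every `ρ > 0`, no regularity): crux hypotheses verbatim and
`∫∫ θ'(t)⟪u(t,x), (∂ₐg)(x)c − (∂_c g)(x)a⟫ = 0` for all `θ ∈ C_c^∞((−∞,T₁))` (`T₁ ≤ 0`), all scalar test functions `g`, all `a, c ∈ ℝ³`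
⇒ `u = 0` a.e. on the slab. [folklore] -/
theorem Loc.ae_eq_zero_of_frozenCurl {ρ : ℝ} (hρ : 0 < ρ)
    {u : ℝ → EuclideanSpace ℝ (Fin 3) → EuclideanSpace ℝ (Fin 3)} {p : ℝ → EuclideanSpace ℝ (Fin 3) → ℝ}
    {H : ℝ → EuclideanSpace ℝ (Fin 3) → EuclideanSpace ℝ (Fin 3) →L[ℝ] EuclideanSpace ℝ (Fin 3)} {c : ℝ≥0}
    (hsw : IsSuitableWeakSolutionOn (slab (EuclideanSpace ℝ (Fin 3)) (Iio 0) isOpen_Iio) 0 0 u p)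
    (hH : HasWeakSpatialGradientOn (slab (EuclideanSpace ℝ (Fin 3)) (Iio 0) isOpen_Iio) u H)
    (hgauge : ∀ a : ℝ, 0 < a →
      ENNReal.ofReal (a ^ (2 * ρ)) * cknA a (0 : ℝ × EuclideanSpace ℝ (Fin 3)) u +
          ENNReal.ofReal (a ^ ρ) * cknE a (0 : ℝ × EuclideanSpace ℝ (Fin 3)) H +
        ENNReal.ofReal (a ^ (2 * ρ)) * cknD a (0 : ℝ × EuclideanSpace ℝ (Fin 3)) p ≤ (c : ℝ≥0∞))
    {T₁ : ℝ} (hT₁ : T₁ ≤ 0)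
    (hvort : ∀ θ : ℝ → ℝ, ContDiff ℝ ∞ θ → HasCompactSupport θ → tsupport θ ⊆ Iio T₁ →
      ∀ g : EuclideanSpace ℝ (Fin 3) → ℝ, IsTestFunctionOn (⊤ : Opens (EuclideanSpace ℝ (Fin 3))) g →
        ∀ a c : EuclideanSpace ℝ (Fin 3),
          ∫ z : ℝ × EuclideanSpace ℝ (Fin 3), deriv θ z.1 * ⟪u z.1 z.2, fderiv ℝ g z.2 a • c - fderiv ℝ g z.2 c • a⟫ = 0) :
    uncurry u =ᵐ[volume.restrict (Iio (0 : ℝ) ×ˢ (univ : Set (EuclideanSpace ℝ (Fin 3))))] 0 := by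
  have hA : ∀ a : ℝ, 0 < a → ENNReal.ofReal (a ^ (2 * ρ)) *
      cknA a (0 : ℝ × EuclideanSpace ℝ (Fin 3)) u ≤ (c : ℝ≥0∞) :=
    fun a ha => le_trans (le_trans le_self_add le_self_add) (hgauge a ha)
  have hsteady : ∀ θ : ℝ → ℝ, ContDiff ℝ ∞ θ → HasCompactSupport θ → tsupport θ ⊆ Iio T₁ →
      ∀ Φ : EuclideanSpace ℝ (Fin 3) → EuclideanSpace ℝ (Fin 3), Continuous Φ → HasCompactSupport Φ →
        ∫ z : ℝ × EuclideanSpace ℝ (Fin 3), deriv θ z.1 * ⟪u z.1 z.2, Φ z.2⟫ = 0 :=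
    fun θ hθ hθc hθT Φ hΦ hΦc =>
      FrozenCurl.integral_deriv_mul_inner_eq_zero (by linarith) hsw hA hT₁ hθ hθc hθT (hvort θ hθ hθc hθT) hΦ hΦc
  have hu : LocallyIntegrableOn (uncurry u) (Iio T₁ ×ˢ (univ : Set (EuclideanSpace ℝ (Fin 3)))) volume := by
    have h0 : LocallyIntegrableOn (uncurry u) (Iio (0 : ℝ) ×ˢ (univ : Set (EuclideanSpace ℝ (Fin 3)))) volume := by
      simpa only [coe_slab] using hsw.distributional.1
    exact h0.mono_set (prod_mono (Iio_subset_Iio hT₁) Subset.rfl)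
  have hsl : ∀ᵐ t ∂(volume.restrict (Iio T₁)), LocallyIntegrable (u t) volume := by
    filter_upwards [FrameSteady.ae_hasWeakFDerivOn_slice_past hH hT₁] with t ht
    exact locallyIntegrableOn_univ.1 (by simpa only [Opens.coe_top] using ht.locallyIntegrableOn)
  obtain ⟨t₀, -, -, hU⟩ := DistSteady.exists_ae_eq_slice hu hsl hsteady
  exact AePastSteady.ae_eq_zero_of_gauge_of_aePastSteady hρ hsw hH hgauge hT₁ hU

/-- **FROZEN ANTISYMMETRIC PART OF THE WEAK GRADIENT ⇒ TRIVIAL.**  The same with the hypothesis phrased on the weak spatial gradient `H`: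
`∫∫ θ'(t) g(x) (⟪H(t,x) a, c⟫ − ⟪H(t,x) c, a⟫) = 0` for all `θ ∈ C_c^∞((−∞,T₁))`, scalar tests `g`, vectors `a, c` (`∂ₜ(H − Hᵀ) = 0` in `𝒟'`;
translated to the curl-pair form by the defining identity of the weak spatial gradient tested with `θ'(t) g(x)`). [folklore] -/
theorem Loc.ae_eq_zero_of_frozenWeakGradientCurl {ρ : ℝ} (hρ : 0 < ρ)
    {u : ℝ → EuclideanSpace ℝ (Fin 3) → EuclideanSpace ℝ (Fin 3)} {p : ℝ → EuclideanSpace ℝ (Fin 3) → ℝ}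
    {H : ℝ → EuclideanSpace ℝ (Fin 3) → EuclideanSpace ℝ (Fin 3) →L[ℝ] EuclideanSpace ℝ (Fin 3)} {c : ℝ≥0}
    (hsw : IsSuitableWeakSolutionOn (slab (EuclideanSpace ℝ (Fin 3)) (Iio 0) isOpen_Iio) 0 0 u p)
    (hH : HasWeakSpatialGradientOn (slab (EuclideanSpace ℝ (Fin 3)) (Iio 0) isOpen_Iio) u H)
    (hgauge : ∀ a : ℝ, 0 < a →
      ENNReal.ofReal (a ^ (2 * ρ)) * cknA a (0 : ℝ × EuclideanSpace ℝ (Fin 3)) u +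
          ENNReal.ofReal (a ^ ρ) * cknE a (0 : ℝ × EuclideanSpace ℝ (Fin 3)) H +
        ENNReal.ofReal (a ^ (2 * ρ)) * cknD a (0 : ℝ × EuclideanSpace ℝ (Fin 3)) p ≤ (c : ℝ≥0∞))
    {T₁ : ℝ} (hT₁ : T₁ ≤ 0)
    (hfrozen : ∀ θ : ℝ → ℝ, ContDiff ℝ ∞ θ → HasCompactSupport θ → tsupport θ ⊆ Iio T₁ →
      ∀ g : EuclideanSpace ℝ (Fin 3) → ℝ, IsTestFunctionOn (⊤ : Opens (EuclideanSpace ℝ (Fin 3))) g →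
        ∀ a c : EuclideanSpace ℝ (Fin 3),
          ∫ t, ∫ x, deriv θ t * g x * (⟪H t x a, c⟫ - ⟪H t x c, a⟫) = 0) :
    uncurry u =ᵐ[volume.restrict (Iio (0 : ℝ) ×ˢ (univ : Set (EuclideanSpace ℝ (Fin 3))))] 0 := by
  refine Loc.ae_eq_zero_of_frozenCurl hρ hsw hH hgauge hT₁ fun θ hθ hθc hθT g hg a c' => ?_
  have hθT0 : tsupport θ ⊆ Iio 0 := hθT.trans (Iio_subset_Iio hT₁)
  obtain ⟨hκ, hκc, hκT⟩ := AntiMember.deriv_cutoff_props hθ hθc hθT0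
  -- the weak-gradient identity tested with `θ'(t) g(x)`
  have hg' : IsTestFunctionOn (⟨univ, isOpen_univ⟩ : Opens (EuclideanSpace ℝ (Fin 3))) g :=
    ⟨hg.contDiff, hg.hasCompactSupport, fun _ _ => trivial⟩
  have hΘ : IsSpaceTimeTestOn (slab (EuclideanSpace ℝ (Fin 3)) (Iio 0) isOpen_Iio) (fun t x => deriv θ t • g x) :=
    isSpaceTimeTestOn_prod_smul isOpen_Iio isOpen_univ (hθ.deriv') hκc hκT hg'
  have hgd : Differentiable ℝ g := hg.contDiff.differentiable (by simp)
  have hW := fun v w => hH.integral_fderiv_mul_inner_eq _ hΘ v w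
  have hfd : ∀ (t : ℝ) (x v : EuclideanSpace ℝ (Fin 3)), fderiv ℝ (fun x => deriv θ t • g x) x v = deriv θ t * fderiv ℝ g x v := by
    intro t x v
    have e : (fun x => deriv θ t • g x) = deriv θ t • g := rfl
    rw [e, fderiv_const_smul (hgd x) (deriv θ t)]
    rfl
  simp_rw [hfd] at hW
  -- the integrand `θ'⟪u, (∂ₐg)c − (∂_c g)a⟫ = θ' ∂ₐg ⟪u,c⟫ − θ' ∂_c g ⟪u,a⟫`
  have hu : LocallyIntegrableOn (uncurry u) (Iio 0 ×ˢ (univ : Set (EuclideanSpace ℝ (Fin 3)))) volume := by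
    simpa only [coe_slab] using hsw.distributional.1
  have iac : ∀ v w : EuclideanSpace ℝ (Fin 3),
      Integrable (fun z : ℝ × EuclideanSpace ℝ (Fin 3) => deriv θ z.1 * fderiv ℝ g z.2 v * ⟪u z.1 z.2, w⟫)
        (volume : Measure (ℝ × EuclideanSpace ℝ (Fin 3))) := by
    intro v w
    have hΦ : Continuous fun x => fderiv ℝ g x v • w :=
      ((hg.contDiff.continuous_fderiv (by simp)).clm_apply continuous_const).smul continuous_const
    have hΦc : HasCompactSupport fun x => fderiv ℝ g x v • w :=
      (hg.hasCompactSupport.fderiv_apply (𝕜 := ℝ) v).smul_right (f' := fun _ : EuclideanSpace ℝ (Fin 3) => w)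
    have h1 := AntiMember.integrable_mul_inner_field hu hκ hκc hκT hΦ hΦc
    refine h1.congr (Eventually.of_forall fun z => ?_)
    simp only [real_inner_smul_right]
    ring
  have e1 : ∫ z : ℝ × EuclideanSpace ℝ (Fin 3), deriv θ z.1 * ⟪u z.1 z.2, fderiv ℝ g z.2 a • c' - fderiv ℝ g z.2 c' • a⟫ =
      (∫ z : ℝ × EuclideanSpace ℝ (Fin 3), deriv θ z.1 * fderiv ℝ g z.2 a * ⟪u z.1 z.2, c'⟫) -
        ∫ z : ℝ × EuclideanSpace ℝ (Fin 3), deriv θ z.1 * fderiv ℝ g z.2 c' * ⟪u z.1 z.2, a⟫ := by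
    rw [← integral_sub (iac a c') (iac c' a)]
    refine integral_congr_ae (Eventually.of_forall fun z => ?_)
    simp only [inner_sub_right, real_inner_smul_right]
    ring
  -- each term, via Fubini, is `−∫∫ θ' g ⟪H ·, ·⟫`
  have e2 : ∀ v w : EuclideanSpace ℝ (Fin 3),
      ∫ z : ℝ × EuclideanSpace ℝ (Fin 3), deriv θ z.1 * fderiv ℝ g z.2 v * ⟪u z.1 z.2, w⟫ =
        -∫ t, ∫ x, deriv θ t * g x * ⟪H t x v, w⟫ := by
    intro v w
    have h1 := iac v w
    rw [Measure.volume_eq_prod] at h1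
    rw [Measure.volume_eq_prod, integral_prod _ h1]
    exact hW v w
  rw [e1, e2 a c', e2 c' a]
  -- `−A + B = 0` from `A − B = ∫∫ θ' g (⟪H a, c⟫ − ⟪H c, a⟫) = 0`
  have iH : ∀ v w : EuclideanSpace ℝ (Fin 3), Integrable (fun t => ∫ x, deriv θ t * g x * ⟪H t x v, w⟫) (volume : Measure ℝ) := by
    intro v w
    have hGl : LocallyIntegrableOn (uncurry H) (Iio 0 ×ˢ (univ : Set (EuclideanSpace ℝ (Fin 3)))) volume := by
      simpa only [coe_slab] using hH.locallyIntegrableOn_grad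
    have hC : IsCompact (tsupport (deriv θ) ×ˢ tsupport g) := hκc.prod hg.hasCompactSupport
    have hCQ : tsupport (deriv θ) ×ˢ tsupport g ⊆ ((slab (EuclideanSpace ℝ (Fin 3)) (Iio 0) isOpen_Iio :
        Opens (ℝ × EuclideanSpace ℝ (Fin 3))) : Set (ℝ × EuclideanSpace ℝ (Fin 3))) := by
      rw [coe_slab]; exact prod_mono hκT (subset_univ _)
    have h2 := integrable_mul_inner_apply_of_locallyIntegrableOn (Q := slab (EuclideanSpace ℝ (Fin 3)) (Iio 0) isOpen_Iio)
      (by simpa only [coe_slab] using hGl) (θ := fun z : ℝ × EuclideanSpace ℝ (Fin 3) => deriv θ z.1 * g z.2)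
      ((hκ.comp continuous_fst).mul (hg.contDiff.continuous.comp continuous_snd)) hC hCQ ?_ v w
    · rw [Measure.volume_eq_prod] at h2
      exact h2.integral_prod_left
    · intro z hz
      rcases not_and_or.1 (fun h => hz (mem_prod.2 h)) with h | h
      · simp [image_eq_zero_of_notMem_tsupport h]
      · simp [image_eq_zero_of_notMem_tsupport h]
  have h3 := hfrozen θ hθ hθc hθT g hg a c'
  have e3 : ∫ t, ∫ x, deriv θ t * g x * (⟪H t x a, c'⟫ - ⟪H t x c', a⟫) =
      (∫ t, ∫ x, deriv θ t * g x * ⟪H t x a, c'⟫) - ∫ t, ∫ x, deriv θ t * g x * ⟪H t x c', a⟫ := by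
    rw [← integral_sub (iH a c') (iH c' a)]
    refine integral_congr_ae ?_
    have hGl : LocallyIntegrableOn (uncurry H) (Iio 0 ×ˢ (univ : Set (EuclideanSpace ℝ (Fin 3)))) volume := by
      simpa only [coe_slab] using hH.locallyIntegrableOn_grad
    -- inner integrals split where both slices are integrable (a.e. `t`)
    have hC : IsCompact (tsupport (deriv θ) ×ˢ tsupport g) := hκc.prod hg.hasCompactSupport
    have hCQ : tsupport (deriv θ) ×ˢ tsupport g ⊆ ((slab (EuclideanSpace ℝ (Fin 3)) (Iio 0) isOpen_Iio :
        Opens (ℝ × EuclideanSpace ℝ (Fin 3))) : Set (ℝ × EuclideanSpace ℝ (Fin 3))) := by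
      rw [coe_slab]; exact prod_mono hκT (subset_univ _)
    have hI : ∀ v w : EuclideanSpace ℝ (Fin 3), Integrable (fun z : ℝ × EuclideanSpace ℝ (Fin 3) => (deriv θ z.1 * g z.2) * ⟪H z.1 z.2 v, w⟫)
        ((volume : Measure ℝ).prod (volume : Measure (EuclideanSpace ℝ (Fin 3)))) := by
      intro v w
      have h2 := integrable_mul_inner_apply_of_locallyIntegrableOn (Q := slab (EuclideanSpace ℝ (Fin 3)) (Iio 0) isOpen_Iio)
        (by simpa only [coe_slab] using hGl) (θ := fun z : ℝ × EuclideanSpace ℝ (Fin 3) => deriv θ z.1 * g z.2)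
        ((hκ.comp continuous_fst).mul (hg.contDiff.continuous.comp continuous_snd)) hC hCQ ?_ v w
      · rwa [Measure.volume_eq_prod] at h2
      · intro z hz
        rcases not_and_or.1 (fun h => hz (mem_prod.2 h)) with h | h
        · simp [image_eq_zero_of_notMem_tsupport h]
        · simp [image_eq_zero_of_notMem_tsupport h]
    filter_upwards [(hI a c').prod_right_ae, (hI c' a).prod_right_ae] with t h1 h2
    rw [← integral_sub h1 h2]
    refine integral_congr_ae (Eventually.of_forall fun x => ?_)
    ring
  rw [e3] at h3
  linarith

/-- **Binder language: no member has frozen weak vorticity in its far past** — for some `T₁ ≤ 0`, the antisymmetric part of the weak gradient is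
distributionally time-independent on `(−∞,T₁) × ℝ³`: `∫∫ θ'(t) g(x) (⟪H a, c⟫ − ⟪H c, a⟫) = 0` for all `θ ∈ C_c^∞((−∞,T₁))`, tests `g`, vectors `a, c`.
Contains the steady (`IsPastSteady` sense 1) and weakly-irrotational-past (`IsWeakTamePast` sense 1) strata. [folklore] -/
theorem Birth.nonSelfSimilar_of_frozenWeakVorticity :
    ∀ ρ : ℝ, 0 < ρ →
      ∀ (u : ℝ → EuclideanSpace ℝ (Fin 3) → EuclideanSpace ℝ (Fin 3)) (p : ℝ → EuclideanSpace ℝ (Fin 3) → ℝ)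
        (H : ℝ → EuclideanSpace ℝ (Fin 3) → EuclideanSpace ℝ (Fin 3) →L[ℝ] EuclideanSpace ℝ (Fin 3)) (c : ℝ≥0),
        Birth.InClass ρ u p H c →
          (∃ T₁ : ℝ, T₁ ≤ 0 ∧ ∀ θ : ℝ → ℝ, ContDiff ℝ ∞ θ → HasCompactSupport θ → tsupport θ ⊆ Iio T₁ →
              ∀ g : EuclideanSpace ℝ (Fin 3) → ℝ, IsTestFunctionOn (⊤ : Opens (EuclideanSpace ℝ (Fin 3))) g →
                ∀ a c : EuclideanSpace ℝ (Fin 3),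
                  ∫ t, ∫ x, deriv θ t * g x * (⟪H t x a, c⟫ - ⟪H t x c, a⟫) = 0) →
          uncurry u =ᵐ[volume.restrict (Iio (0 : ℝ) ×ˢ (univ : Set (EuclideanSpace ℝ (Fin 3))))] 0 := by
  intro ρ hρ u p H c hcl h
  obtain ⟨T₁, hT₁, hfrozen⟩ := h
  exact Loc.ae_eq_zero_of_frozenWeakGradientCurl hρ hcl.1 hcl.2.1 hcl.2.2 hT₁ hfrozen

/-! ## 3. The a.e.-frozen form: the antisymmetric part of `H` is a.e. a time-independent field (hand g3, append) -/

/-- **A.E.-FROZEN WEAK VORTICITY ⇒ TRIVIAL.**  If the antisymmetric part of the weak gradient agrees a.e. on the past slab `(−∞,T₁) × ℝ³` with that of a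
TIME-INDEPENDENT field `W : ℝ³ → (ℝ³ →L ℝ³)` — `⟪H(t,x)a, c⟫ − ⟪H(t,x)c, a⟫ = ⟪W(x)a, c⟫ − ⟪W(x)c, a⟫` for a.e. `(t,x)`, all `a, c` (e.g. `W = H(t₀)` an
a.e. slice: «the vorticity does not depend on time») — then the member is trivial: slicing (Fubini) turns the hypothesis into the distributional
frozen-vorticity condition of `Loc.ae_eq_zero_of_frozenWeakGradientCurl`, since `∫ θ' = 0`. [folklore] -/
theorem Loc.ae_eq_zero_of_aeFrozenWeakVorticity {ρ : ℝ} (hρ : 0 < ρ)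
    {u : ℝ → EuclideanSpace ℝ (Fin 3) → EuclideanSpace ℝ (Fin 3)} {p : ℝ → EuclideanSpace ℝ (Fin 3) → ℝ}
    {H : ℝ → EuclideanSpace ℝ (Fin 3) → EuclideanSpace ℝ (Fin 3) →L[ℝ] EuclideanSpace ℝ (Fin 3)} {c : ℝ≥0}
    (hsw : IsSuitableWeakSolutionOn (slab (EuclideanSpace ℝ (Fin 3)) (Iio 0) isOpen_Iio) 0 0 u p)
    (hH : HasWeakSpatialGradientOn (slab (EuclideanSpace ℝ (Fin 3)) (Iio 0) isOpen_Iio) u H)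
    (hgauge : ∀ a : ℝ, 0 < a →
      ENNReal.ofReal (a ^ (2 * ρ)) * cknA a (0 : ℝ × EuclideanSpace ℝ (Fin 3)) u +
          ENNReal.ofReal (a ^ ρ) * cknE a (0 : ℝ × EuclideanSpace ℝ (Fin 3)) H +
        ENNReal.ofReal (a ^ (2 * ρ)) * cknD a (0 : ℝ × EuclideanSpace ℝ (Fin 3)) p ≤ (c : ℝ≥0∞))
    {T₁ : ℝ} (hT₁ : T₁ ≤ 0) {W : EuclideanSpace ℝ (Fin 3) → EuclideanSpace ℝ (Fin 3) →L[ℝ] EuclideanSpace ℝ (Fin 3)}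
    (hfrozen : ∀ᵐ z ∂(volume.restrict (Iio T₁ ×ˢ (univ : Set (EuclideanSpace ℝ (Fin 3))))), ∀ a b : EuclideanSpace ℝ (Fin 3),
      ⟪H z.1 z.2 a, b⟫ - ⟪H z.1 z.2 b, a⟫ = ⟪W z.2 a, b⟫ - ⟪W z.2 b, a⟫) :
    uncurry u =ᵐ[volume.restrict (Iio (0 : ℝ) ×ˢ (univ : Set (EuclideanSpace ℝ (Fin 3))))] 0 := by
  refine Loc.ae_eq_zero_of_frozenWeakGradientCurl hρ hsw hH hgauge hT₁ fun θ hθ hθc hθT g _ a c' => ?_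
  -- slices of the a.e. hypothesis
  have e : (volume.restrict (Iio T₁ ×ˢ (univ : Set (EuclideanSpace ℝ (Fin 3)))) : Measure (ℝ × EuclideanSpace ℝ (Fin 3))) =
      ((volume : Measure ℝ).restrict (Iio T₁)).prod (volume : Measure (EuclideanSpace ℝ (Fin 3))) := by
    rw [Measure.volume_eq_prod, ← Measure.restrict_univ (μ := (volume : Measure (EuclideanSpace ℝ (Fin 3)))),
      Measure.prod_restrict, Measure.restrict_univ]
  rw [e] at hfrozen
  have hsl := Measure.ae_ae_of_ae_prod hfrozen
  set C : ℝ := ∫ x, g x * (⟪W x a, c'⟫ - ⟪W x c', a⟫) with hC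
  have hpt : ∀ᵐ t ∂(volume : Measure ℝ),
      ∫ x, deriv θ t * g x * (⟪H t x a, c'⟫ - ⟪H t x c', a⟫) = deriv θ t * C := by
    filter_upwards [ae_imp_of_ae_restrict hsl] with t ht
    by_cases htT : t < T₁
    · have h2 := ht htT
      rw [hC, ← integral_const_mul]
      refine integral_congr_ae ?_
      filter_upwards [h2] with x hx
      rw [mul_assoc, hx a c']
    · rw [AntiMember.deriv_eq_zero_of_tsupport_subset_Iio hθT (not_lt.1 htT)]
      simp
  rw [integral_congr_ae hpt, integral_mul_const,
    Elgindi.integral_deriv_eq_zero_of_hasCompactSupport (hθ.of_le (by norm_cast)) hθc, zero_mul]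

/-- **Binder language: NO MEMBER HAS TIME-INDEPENDENT VORTICITY IN ITS FAR PAST (a.e. form).**  For some `T₁ ≤ 0` and some time-independent
`W : ℝ³ → (ℝ³ →L ℝ³)`, the antisymmetric part of the weak gradient `H(t,x)` equals that of `W(x)` for a.e. `(t,x) ∈ (−∞,T₁) × ℝ³` ⇒ the member is
trivial.  Contains: steady past (`W = H(t₀)`), weakly irrotational past (`W = 0`), wrong-parity / anti-periodic / generalised-Beltrami pasts.
[folklore] -/
theorem Birth.nonSelfSimilar_of_aeFrozenWeakVorticity :
    ∀ ρ : ℝ, 0 < ρ →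
      ∀ (u : ℝ → EuclideanSpace ℝ (Fin 3) → EuclideanSpace ℝ (Fin 3)) (p : ℝ → EuclideanSpace ℝ (Fin 3) → ℝ)
        (H : ℝ → EuclideanSpace ℝ (Fin 3) → EuclideanSpace ℝ (Fin 3) →L[ℝ] EuclideanSpace ℝ (Fin 3)) (c : ℝ≥0),
        Birth.InClass ρ u p H c →
          (∃ T₁ : ℝ, T₁ ≤ 0 ∧ ∃ W : EuclideanSpace ℝ (Fin 3) → EuclideanSpace ℝ (Fin 3) →L[ℝ] EuclideanSpace ℝ (Fin 3),
              ∀ᵐ z ∂(volume.restrict (Iio T₁ ×ˢ (univ : Set (EuclideanSpace ℝ (Fin 3))))), ∀ a b : EuclideanSpace ℝ (Fin 3),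
                ⟪H z.1 z.2 a, b⟫ - ⟪H z.1 z.2 b, a⟫ = ⟪W z.2 a, b⟫ - ⟪W z.2 b, a⟫) →
          uncurry u =ᵐ[volume.restrict (Iio (0 : ℝ) ×ˢ (univ : Set (EuclideanSpace ℝ (Fin 3))))] 0 := by
  intro ρ hρ u p H c hcl h
  obtain ⟨T₁, hT₁, W, hfrozen⟩ := h
  exact Loc.ae_eq_zero_of_aeFrozenWeakVorticity hρ hcl.1 hcl.2.1 hcl.2.2 hT₁ hfrozen

/-- **In particular (`W = 0`): a member whose weak gradient is a.e. SYMMETRIC on a past slab (weakly irrotational past) is trivial** — a second proof of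
the tree's `PastWeak.ae_eq_zero_of_gauge_of_pastWeaklyIrrotational`, through frozen vorticity instead of slice-wise harmonicity. [folklore] -/
theorem Birth.nonSelfSimilar_of_aeSymmetricWeakGradientPast :
    ∀ ρ : ℝ, 0 < ρ →
      ∀ (u : ℝ → EuclideanSpace ℝ (Fin 3) → EuclideanSpace ℝ (Fin 3)) (p : ℝ → EuclideanSpace ℝ (Fin 3) → ℝ)
        (H : ℝ → EuclideanSpace ℝ (Fin 3) → EuclideanSpace ℝ (Fin 3) →L[ℝ] EuclideanSpace ℝ (Fin 3)) (c : ℝ≥0),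
        Birth.InClass ρ u p H c →
          (∃ T₁ : ℝ, T₁ ≤ 0 ∧ ∀ᵐ z ∂(volume.restrict (Iio T₁ ×ˢ (univ : Set (EuclideanSpace ℝ (Fin 3))))),
              ∀ a b : EuclideanSpace ℝ (Fin 3), ⟪H z.1 z.2 a, b⟫ = ⟪H z.1 z.2 b, a⟫) →
          uncurry u =ᵐ[volume.restrict (Iio (0 : ℝ) ×ˢ (univ : Set (EuclideanSpace ℝ (Fin 3))))] 0 := by
  intro ρ hρ u p H c hcl h
  obtain ⟨T₁, hT₁, hsym⟩ := h
  refine Birth.nonSelfSimilar_of_aeFrozenWeakVorticity ρ hρ u p H c hcl ⟨T₁, hT₁, fun _ => 0, ?_⟩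
  filter_upwards [hsym] with z hz a b
  rw [hz a b, sub_self]
  simp

end Summit.NavierStokesRegularity.NavierStokesRegularity.Theorems.PowerGaugeEulerLiouville

end
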